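import Summits.AtomisticToContinuum.Crystallization.Theorems.FrustratedLawDichotomyStrainedPatchHomCentredForm
import Summits.AtomisticToContinuum.Crystallization.Theorems.FrustratedLawDichotomyStrainedPatchHomPolar

/-!
# GRAM COORDINATES for the box floors of the `HomFloor` certificate, and the (P4) fcc leaf in those coordinates

Critic rows 764 (ε) / 769 (decomp-a2c hand-1 g19; CERT-DESIGN-g44 §1): every squared lattice length is LINEAR in the Gram data of the
deformation, `‖latPt G f b‖² = Σᵢⱼ bᵢ bⱼ ⟪G fᵢ, G fⱼ⟫` (any `G`, not only the polar factor), the shifted hcp lengths are linear in the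
extended Gram data `(⟪G fᵢ, G fⱼ⟫, ⟪G fᵢ, G t⟫, ‖G t‖²)`, and `‖G − 1‖ ≤ ε` confines the Gram data to the box
`|⟪G v, G w⟫ − ⟪v, w⟫| ≤ (2ε + ε²)‖v‖‖w‖`.  Consequently a box-floor term `W ‖latPt G f b‖` is the univariate function `W ∘ √` of a
linear functional of the Gram coordinates — exactly the input shape of `…HomCentredForm.leaf_sound_box`; `boxSum_ge_of_gramLeaf` is that
instantiation (coordinates indexed by `Fin 9 ≃ Fin 3 × Fin 3`).  DEF-FREE; standard axioms.  `--supports stmt-AtomisticToContinuum-27623`.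
-/

noncomputable section

namespace Summit.AtomisticToContinuum.Crystallization.Theorems.FrustratedLawDichotomyStrainedPatchHomGram

open scoped BigOperators RealInnerProductSpace
open Set
open Summit.AtomisticToContinuum.Crystallization.Theorems.ChargedEnergyGapNegative (E3)
open Summit.AtomisticToContinuum.Crystallization.Theorems.FrustratedLawDichotomyStrainedPatchHomSplit
open Summit.AtomisticToContinuum.Crystallization.Theorems.FrustratedLawDichotomyStrainedPatchHomCentredForm
open Summit.AtomisticToContinuum.Crystallization.Theorems.FrustratedLawDichotomyStrainedPatchHomPolar

/-! ## §1. Squared lengths are linear in the Gram data -/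

/-- `‖G (Σᵢ aᵢ fᵢ)‖² = Σᵢ Σⱼ aᵢ aⱼ ⟪G fᵢ, G fⱼ⟫` (any deformation `G`, any frame, any real coefficients). [folklore] -/
theorem norm_sq_map_sum_smul {n : ℕ} (G : E3 →L[ℝ] E3) (f : Fin n → E3) (a : Fin n → ℝ) :
    ‖G (∑ i, a i • f i)‖ ^ 2 = ∑ i, ∑ j, a i * a j * ⟪G (f i), G (f j)⟫ := by
  rw [← real_inner_self_eq_norm_sq, map_sum, sum_inner]
  refine Finset.sum_congr rfl fun i _ => ?_
  rw [inner_sum]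
  refine Finset.sum_congr rfl fun j _ => ?_
  rw [map_smul, map_smul, real_inner_smul_left, real_inner_smul_right]; ring

/-- `‖latPt G f b‖² = Σᵢ Σⱼ bᵢ bⱼ ⟪G fᵢ, G fⱼ⟫`. [folklore] -/
theorem norm_sq_latPt_eq_sum_gram (G : E3 →L[ℝ] E3) (f : Fin 3 → E3) (b : Fin 3 → ℤ) :
    ‖latPt G f b‖ ^ 2 = ∑ i, ∑ j, (b i : ℝ) * (b j : ℝ) * ⟪G (f i), G (f j)⟫ := by
  unfold latPt; exact norm_sq_map_sum_smul G f _

/-- Shifted (hcp `B`-sublattice) lengths: `‖latPt G f b + G t‖² = Σᵢⱼ bᵢbⱼ⟪Gfᵢ,Gfⱼ⟫ + 2 Σᵢ bᵢ⟪Gfᵢ,Gt⟫ + ‖Gt‖²` — linear in the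
extended Gram data. [folklore] -/
theorem norm_sq_latPt_add_eq_sum_gram (G : E3 →L[ℝ] E3) (f : Fin 3 → E3) (b : Fin 3 → ℤ) (t : E3) :
    ‖latPt G f b + G t‖ ^ 2 =
      ∑ i, ∑ j, (b i : ℝ) * (b j : ℝ) * ⟪G (f i), G (f j)⟫ + 2 * ∑ i, (b i : ℝ) * ⟪G (f i), G t⟫ + ‖G t‖ ^ 2 := by
  rw [← real_inner_self_eq_norm_sq, inner_add_left, inner_add_right, inner_add_right, real_inner_self_eq_norm_sq,
    real_inner_self_eq_norm_sq, norm_sq_latPt_eq_sum_gram, real_inner_comm (latPt G f b) (G t)]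
  have h1 : ⟪latPt G f b, G t⟫ = ∑ i, (b i : ℝ) * ⟪G (f i), G t⟫ := by
    unfold latPt
    rw [map_sum, sum_inner]
    refine Finset.sum_congr rfl fun i _ => ?_
    rw [map_smul, real_inner_smul_left]
  rw [h1]; ring

/-- For a self-adjoint `U` the Gram data are the FRAME GRAM ENTRIES OF `C = U²`: `⟪U fᵢ, U fⱼ⟫ = ⟪fᵢ, U (U fⱼ)⟫`. [folklore] -/
theorem gram_eq_inner_sq_of_selfAdjoint {U : E3 →L[ℝ] E3} (hU : ∀ v w : E3, ⟪U v, w⟫ = ⟪v, U w⟫) (v w : E3) :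
    ⟪U v, U w⟫ = ⟪v, U (U w)⟫ := hU v (U w)

/-! ## §2. The Gram box from `‖G − 1‖ ≤ ε` -/

/-- `|⟪G v, G w⟫ − ⟪v, w⟫| ≤ (2ε + ε²)·‖v‖·‖w‖` for `‖G − 1‖ ≤ ε`
(`⟪Gv, Gw⟫ − ⟪v, w⟫ = ⟪(G−1)v, (G−1)w⟫ + ⟪(G−1)v, w⟫ + ⟪v, (G−1)w⟫`). [folklore] -/
theorem abs_gram_sub_inner_le {G : E3 →L[ℝ] E3} {ε : ℝ} (hG : ‖G - 1‖ ≤ ε) (v w : E3) :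
    |⟪G v, G w⟫ - ⟪v, w⟫| ≤ (2 * ε + ε ^ 2) * ‖v‖ * ‖w‖ := by
  have hε : 0 ≤ ε := (norm_nonneg _).trans hG
  have hv : ‖(G - 1) v‖ ≤ ε * ‖v‖ := (ContinuousLinearMap.le_opNorm _ _).trans (mul_le_mul_of_nonneg_right hG (norm_nonneg _))
  have hw : ‖(G - 1) w‖ ≤ ε * ‖w‖ := (ContinuousLinearMap.le_opNorm _ _).trans (mul_le_mul_of_nonneg_right hG (norm_nonneg _))
  have hdec : ⟪G v, G w⟫ - ⟪v, w⟫ = ⟪(G - 1) v, (G - 1) w⟫ + ⟪(G - 1) v, w⟫ + ⟪v, (G - 1) w⟫ := by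
    have e1 : (G - 1) v = G v - v := rfl
    have e2 : (G - 1) w = G w - w := rfl
    simp only [e1, e2, inner_sub_left, inner_sub_right]
    ring
  rw [hdec]
  have h1 : |⟪(G - 1) v, (G - 1) w⟫| ≤ ε * ‖v‖ * (ε * ‖w‖) :=
    (abs_real_inner_le_norm _ _).trans (mul_le_mul hv hw (norm_nonneg _) (by positivity))
  have h2 : |⟪(G - 1) v, w⟫| ≤ ε * ‖v‖ * ‖w‖ :=
    (abs_real_inner_le_norm _ _).trans (mul_le_mul_of_nonneg_right hv (norm_nonneg _))
  have h3 : |⟪v, (G - 1) w⟫| ≤ ‖v‖ * (ε * ‖w‖) :=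
    (abs_real_inner_le_norm _ _).trans (mul_le_mul_of_nonneg_left hw (norm_nonneg _))
  calc |⟪(G - 1) v, (G - 1) w⟫ + ⟪(G - 1) v, w⟫ + ⟪v, (G - 1) w⟫|
      ≤ |⟪(G - 1) v, (G - 1) w⟫| + |⟪(G - 1) v, w⟫| + |⟪v, (G - 1) w⟫| := abs_add_three _ _ _
    _ ≤ ε * ‖v‖ * (ε * ‖w‖) + ε * ‖v‖ * ‖w‖ + ‖v‖ * (ε * ‖w‖) := by linarith
    _ = (2 * ε + ε ^ 2) * ‖v‖ * ‖w‖ := by ring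

/-- Record instance (`ε = 1/4`): `|⟪G v, G w⟫ − ⟪v, w⟫| ≤ (9/16)·‖v‖·‖w‖`. [arithmetic] -/
theorem abs_gram_sub_inner_le_quarter {G : E3 →L[ℝ] E3} (hG : ‖G - 1‖ ≤ 1 / 4) (v w : E3) :
    |⟪G v, G w⟫ - ⟪v, w⟫| ≤ 9 / 16 * ‖v‖ * ‖w‖ := by
  have := abs_gram_sub_inner_le hG v w
  norm_num at this
  linarith

/-- The diagonal Gram data are squeezed: `(1−ε)²‖v‖² ≤ ‖G v‖² ≤ (1+ε)²‖v‖²` (`ε ≤ 1`). [folklore] -/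
theorem norm_sq_map_mem_Icc {G : E3 →L[ℝ] E3} {ε : ℝ} (hG : ‖G - 1‖ ≤ ε) (hε : ε ≤ 1) (v : E3) :
    ‖G v‖ ^ 2 ∈ Icc ((1 - ε) ^ 2 * ‖v‖ ^ 2) ((1 + ε) ^ 2 * ‖v‖ ^ 2) := by
  have hl := norm_apply_ge_of_norm_sub_one_le hG v
  have hu := norm_apply_le_of_norm_sub_one_le hG v
  have h0 : 0 ≤ (1 - ε) * ‖v‖ := mul_nonneg (by linarith) (norm_nonneg _)
  constructor
  · rw [← mul_pow]; exact pow_le_pow_left₀ h0 hl 2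
  · rw [← mul_pow]; exact pow_le_pow_left₀ (norm_nonneg _) hu 2

/-! ## §3. The fcc box sum as a sum of univariate terms of linear functionals of the 9 Gram coordinates -/

/-- The box-floor summand in Gram coordinates: `W ‖latPt G f b‖ = (W ∘ √)(Σ_k L_b k · c_k)` with the 9 coordinates
`c_k = ⟪G f (k.1), G f (k.2)⟫` and `L_b k = b (k.1) · b (k.2)`, `k : Fin 9 ≃ Fin 3 × Fin 3`. [formal bookkeeping] -/
theorem summand_eq_gram (W : ℝ → ℝ) (G : E3 →L[ℝ] E3) (f : Fin 3 → E3) (b : Fin 3 → ℤ) :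
    W ‖latPt G f b‖ = (fun q => W (Real.sqrt q))
      (∑ k : Fin 9, ((b ((@finProdFinEquiv 3 3).symm k).1 : ℝ) * (b ((@finProdFinEquiv 3 3).symm k).2 : ℝ)) *
        ⟪G (f ((@finProdFinEquiv 3 3).symm k).1), G (f ((@finProdFinEquiv 3 3).symm k).2)⟫) := by
  have hsum : ∑ k : Fin 9, ((b ((@finProdFinEquiv 3 3).symm k).1 : ℝ) * (b ((@finProdFinEquiv 3 3).symm k).2 : ℝ)) *
        ⟪G (f ((@finProdFinEquiv 3 3).symm k).1), G (f ((@finProdFinEquiv 3 3).symm k).2)⟫ = ‖latPt G f b‖ ^ 2 := by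
    rw [norm_sq_latPt_eq_sum_gram, ← Finset.sum_product', Finset.univ_product_univ]
    exact Fintype.sum_equiv (@finProdFinEquiv 3 3).symm _ _ fun k => rfl
  simp only [hsum, Real.sqrt_sq (norm_nonneg _)]

/-- ★★ **(P4) fcc LEAF SOUNDNESS IN GRAM COORDINATES.**  Data: centre `c₀ : Fin 9 → ℝ`, half-widths `w ≥ 0`, per box label `b`
a curvature constant `M_b ≥ 0` such that `φ = W ∘ √` is differentiable with `φ′ + M_b·id` monotone on the term's box range, and the
checker's inequality.  Conclusion: for EVERY deformation `G` whose frame Gram data `⟪G fᵢ, G fⱼ⟫` lie in the box, the box sum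
`Σ_{b ∈ box} W ‖latPt G f b‖` is at least `μ`. [folklore] -/
theorem boxSum_ge_of_gramLeaf (W W' : ℝ → ℝ) (box : Finset (Fin 3 → ℤ)) (f : Fin 3 → E3) (M : (Fin 3 → ℤ) → ℝ)
    (c₀ w : Fin 9 → ℝ) (μ : ℝ) (hw : ∀ k, 0 ≤ w k) (hM : ∀ b ∈ box, 0 ≤ M b)
    (hd : ∀ b ∈ box, ∀ t ∈ Icc
        (∑ k, ((b ((@finProdFinEquiv 3 3).symm k).1 : ℝ) * (b ((@finProdFinEquiv 3 3).symm k).2 : ℝ)) * c₀ k -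
          ∑ k, |((b ((@finProdFinEquiv 3 3).symm k).1 : ℝ) * (b ((@finProdFinEquiv 3 3).symm k).2 : ℝ))| * w k)
        (∑ k, ((b ((@finProdFinEquiv 3 3).symm k).1 : ℝ) * (b ((@finProdFinEquiv 3 3).symm k).2 : ℝ)) * c₀ k +
          ∑ k, |((b ((@finProdFinEquiv 3 3).symm k).1 : ℝ) * (b ((@finProdFinEquiv 3 3).symm k).2 : ℝ))| * w k),
        HasDerivAt (fun q => W (Real.sqrt q)) (W' t) t)
    (hmono : ∀ b ∈ box, MonotoneOn (fun t => W' t + M b * t) (Icc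
        (∑ k, ((b ((@finProdFinEquiv 3 3).symm k).1 : ℝ) * (b ((@finProdFinEquiv 3 3).symm k).2 : ℝ)) * c₀ k -
          ∑ k, |((b ((@finProdFinEquiv 3 3).symm k).1 : ℝ) * (b ((@finProdFinEquiv 3 3).symm k).2 : ℝ))| * w k)
        (∑ k, ((b ((@finProdFinEquiv 3 3).symm k).1 : ℝ) * (b ((@finProdFinEquiv 3 3).symm k).2 : ℝ)) * c₀ k +
          ∑ k, |((b ((@finProdFinEquiv 3 3).symm k).1 : ℝ) * (b ((@finProdFinEquiv 3 3).symm k).2 : ℝ))| * w k)))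
    (hcheck : μ ≤ ∑ b ∈ box, W (Real.sqrt (∑ k, ((b ((@finProdFinEquiv 3 3).symm k).1 : ℝ) * (b ((@finProdFinEquiv 3 3).symm k).2 : ℝ)) * c₀ k))
        - ∑ k, |∑ b ∈ box, W' (∑ j, ((b ((@finProdFinEquiv 3 3).symm j).1 : ℝ) * (b ((@finProdFinEquiv 3 3).symm j).2 : ℝ)) * c₀ j) *
            (((b ((@finProdFinEquiv 3 3).symm k).1 : ℝ) * (b ((@finProdFinEquiv 3 3).symm k).2 : ℝ)))| * w k
        - 1 / 2 * ∑ b ∈ box, M b * (∑ k, |((b ((@finProdFinEquiv 3 3).symm k).1 : ℝ) * (b ((@finProdFinEquiv 3 3).symm k).2 : ℝ))| * w k) ^ 2)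
    (G : E3 →L[ℝ] E3)
    (hbox : ∀ k : Fin 9, |⟪G (f ((@finProdFinEquiv 3 3).symm k).1), G (f ((@finProdFinEquiv 3 3).symm k).2)⟫ - c₀ k| ≤ w k) :
    μ ≤ ∑ b ∈ box, W ‖latPt G f b‖ := by
  have h := leaf_sound_box box
    (fun b k => ((b ((@finProdFinEquiv 3 3).symm k).1 : ℝ) * (b ((@finProdFinEquiv 3 3).symm k).2 : ℝ)))
    (fun _ q => W (Real.sqrt q)) (fun _ t => W' t) M c₀ w μ hw hM hd hmono hcheck
    (fun k => ⟪G (f ((@finProdFinEquiv 3 3).symm k).1), G (f ((@finProdFinEquiv 3 3).symm k).2)⟫) hbox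
  simpa only [summand_eq_gram] using h

end Summit.AtomisticToContinuum.Crystallization.Theorems.FrustratedLawDichotomyStrainedPatchHomGram

end
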